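/-
Copyright (c) 2026. All rights reserved.
Released under Apache 2.0 license as described in the file LICENSE.
Authors: abc-iut cell, prover seat abc-iut-w5-d180 (wave 5, gen 7).
-/
import Literature.IUT.LogVolume.TensorPacketLicenceCellOrders
import HarnessLib

/-!
# The U2 cell in INTEGER ORDERS form at a packet of PAIRWISE-ISOMORPHIC slots (Galois-conjugate completions),
# everything in `p`-power form — the shape of the genuine tuples `v⃗` over one prime of a Galois number field

abc-iut cell, seat abc-iut-w5-d180 (D-0079 sub-cell R-W, lane U; sequel of `TensorPacketLicenceCellOrders`, p459071).  PROOF-ONLY file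
(no definitions, no named `Prop` facts).  `TensorPacketLicenceCellOrders.iota_smul_subset_packetHull_…_iff_orders` reads abc-iut-c312-5's
exact cell at the CONSTANT family `k_i = K`.  At a genuine datum the summand of a packet `(j, p)` indexed by a tuple `v⃗` of places of a
GALOIS field `K` over `p` is the family `a ↦ K_{v_a}` of pairwise isomorphic — not literally equal — completions.  This file states the
same integer predicate for such families, with every norm datum in `p`-power form (`‖·‖ = p^{−(integer)/e}`, `e` the common ramification
index), so that no uniformiser of any slot has to be chosen:

* `zpow_mul_rpow_le_rpow_mul_rpow_pow_iff` — real bookkeeping: `p^m·p^{−A/e} ≤ p^{−X}·(p^{−B/e})^n ⟺ m·e − A ≤ −X·e − n·B`;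
* **`iota_smul_subset_packetHull_orbit_iota_smul_iff_orders_of_algEquiv`** / **`…factorwiseOrbit…_of_algEquiv`** — for a family `k` with
  `ℚ_p`-algebra isomorphisms `τ_i : K ≃ k_i` (so `d_I − min_J d_{L_J} = (|I|−1)·d_K`, abc-iut-w6-d018), `differentOrd K = D/e`, inner/outer
  witnesses with `‖c_in i‖ = p^{−R_in/e}`, `‖c_out i‖ = p^{−R_out/e}`, and `‖t_Θ‖ = p^{−M/e}`, `‖t_q‖ = p^{−m_q/e}`:
  **cell ⟺ `e·((M − (|I|−1)·D − |I|·R_in) / e) + |I|·R_out ≤ m_q`** (any positive integer `e`; `/` = Int floor division).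

READING: this is the form the window certificates' genuine rows consume (realising ideles: `‖t_{Θ,j,w}‖ = p^{−j²P_w/e_w}`, `‖t_{q,w}‖ = p^{−P_w/e_w}`,
abc-iut-w4-d036 `licence_settingPrVolSharp_iff_shellRadii_of_realises`, p460573), once the tuple's completions are identified with one `K_w`
by the Galois action.  HONEST SCOPE: OUR typed containers and DH's typed (Ind2); per-summand STRONGER-THAN-PRINT reading of [IUTchIII] Cor. 3.12
Step (xi-f); nothing about the printed inequality; no side taken. [cite: Mochizuki2012, IUTchIV Prop. 1.1 p. 9, Prop. 1.2 (i)(ii) p. 10]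
[cite: DupuyHilado2025, §3.4, §4.9, §4.12] [claim: Mochizuki2012, status: disputed].
-/

noncomputable section

open Set Module Function
open scoped Pointwise TensorProduct NormedField

namespace Literature.IUT.LogVolume

open Literature.NumberTheory.GaloisRepresentations.Ultrametric

variable (p : ℕ) [hp : Fact p.Prime]

/-! ## 1. Real bookkeeping in `p`-power form -/

/-- `p^m·p^{−A/e} ≤ p^{−X}·(p^{−B/e})^n ⟺ m·e − A ≤ −X·e − n·B` (`e > 0`). [cite: NeukirchANT1999, Ch. II (5.5)] -/
theorem zpow_mul_rpow_le_rpow_mul_rpow_pow_iff {e : ℕ} (he : 0 < e) (m A B : ℤ) (X : ℝ) (n : ℕ) :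
    (p : ℝ) ^ m * (p : ℝ) ^ (-((A : ℝ) / e)) ≤ (p : ℝ) ^ (-X) * ((p : ℝ) ^ (-((B : ℝ) / e))) ^ n ↔
      (m : ℝ) * e - A ≤ -X * e - n * B := by
  have hp1 : (1 : ℝ) < p := by exact_mod_cast hp.out.one_lt
  have hp0 : (0 : ℝ) < p := by linarith
  have he' : (0 : ℝ) < e := by exact_mod_cast he
  rw [← Real.rpow_intCast, ← Real.rpow_add hp0, ← Real.rpow_natCast, ← Real.rpow_mul hp0.le, ← Real.rpow_add hp0,
    Real.rpow_le_rpow_left_iff hp1]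
  have key1 : ((m : ℤ) : ℝ) + -((A : ℝ) / e) = ((m : ℝ) * e - A) / e := by
    rw [eq_div_iff he'.ne']; field_simp; ring
  have key2 : -X + -((B : ℝ) / e) * (n : ℝ) = (-X * e - n * B) / e := by
    rw [eq_div_iff he'.ne']; field_simp; ring
  rw [key1, key2, div_le_div_iff_of_pos_right he']

/-- The integer heart: `(∀ m, m·e ≤ N → e·m + R ≤ q) ⟺ e·(N / e) + R ≤ q` (`0 < e`). [folklore] -/
private theorem forall_int_mul_le_imp_iff_ediv' {e : ℤ} (he : 0 < e) (N R q : ℤ) :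
    (∀ m : ℤ, m * e ≤ N → e * m + R ≤ q) ↔ e * (N / e) + R ≤ q := by
  constructor
  · intro h
    exact h (N / e) (Int.ediv_mul_le N he.ne')
  · intro h m hm
    have hm' : m ≤ N / e := Int.le_ediv_of_mul_le he hm
    nlinarith

/-! ## 2. The cell at a packet of pairwise isomorphic slots -/

section Conjugate

variable {I : Type} [Fintype I] [DecidableEq I] [Nonempty I]
variable (k : I → Type) [∀ i, NontriviallyNormedField (k i)] [∀ i, NormedAlgebra ℚ_[p] (k i)]
  [∀ i, IsUltrametricDist (k i)] [∀ i, ProperSpace (k i)]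
variable {K : Type} [NontriviallyNormedField K] [NormedAlgebra ℚ_[p] K] [IsUltrametricDist K] [ProperSpace K]

omit [DecidableEq I] [IsUltrametricDist K] [ProperSpace K] in
/-- Pairwise isomorphic slots: `d_I − min_J d_{L_J} = (|I| − 1)·d_K` (abc-iut-w6-d018's equal-slots theorem, transported along
`τ_i : K ≃ k_i`). [cite: Mochizuki2012, IUTchIV Prop. 1.1 p. 9] -/
theorem dSum_sub_inf_differentOrd_dFac_eq_of_algEquiv' [IsUltrametricDist K] [ProperSpace K] (τ : ∀ i, K ≃ₐ[ℚ_[p]] k i) :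
    dSum p k - (Finset.univ : Finset (DIdx p k)).inf' Finset.univ_nonempty (fun J => differentOrd p (DFac p k J)) =
      ((Fintype.card I : ℝ) - 1) * differentOrd p K := by
  classical
  obtain ⟨i₀⟩ := (inferInstance : Nonempty I)
  rw [dSum_sub_inf_differentOrd_dFac_eq_of_algEquiv p k i₀ (fun i => (τ i₀).symm.trans (τ i)),
    differentOrd_eq_of_algEquiv_isometry p k (i₀ := i₀) (i := i₀) (AlgEquiv.refl)]
  congr 1
  exact (differentOrd_eq_of_isometry_of_surjective p (τ i₀ : K →ₐ[ℚ_[p]] k i₀)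
    (fun x => norm_map_algHom (τ i₀ : K →ₐ[ℚ_[p]] k i₀) x) (τ i₀).surjective).symm

/-- **THE CELL IN INTEGER ORDERS AT A PACKET OF PAIRWISE ISOMORPHIC SLOTS (Dupuy–Hilado's full (Ind2)).**  Slots `k_i ≃ K` over `ℚ_p`,
`differentOrd K = D/e`, `‖c_in i‖ = p^{−R_in/e}`, `‖c_out i‖ = p^{−R_out/e}` (abc-iut-c312-5's binders), `‖t_Θ‖ = p^{−M/e}`, `‖t_q‖ = p^{−m_q/e}`
for a positive integer `e`: **cell ⟺ `e·((M − (|I|−1)·D − |I|·R_in) / e) + |I|·R_out ≤ m_q`.**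
[cite: DupuyHilado2025, §3.4, §4.9, §4.12] [cite: Mochizuki2012, IUTchIV Prop. 1.1 p. 9, Prop. 1.2 (i)(ii) p. 10] -/
theorem iota_smul_subset_packetHull_orbit_iota_smul_iff_orders_of_algEquiv (τ : ∀ i, K ≃ₐ[ℚ_[p]] k i) {e : ℕ} (he : 0 < e)
    {D : ℕ} (hD : differentOrd p K = (D : ℝ) / e) {cin cout : Π i, k i} (hin0 : ∀ i, cin i ≠ 0)
    (hin : ∀ i (o : k i), ‖o‖ ≤ 1 → cin i * o ∈ logUnits (k i))
    (hmax : ∀ i, ∃ (ϖ : (k i)ˣ) (w : k i), IsUniformizer ϖ ∧ w ∉ logUnits (k i) ∧ ‖w‖ * ‖(ϖ : k i)‖ ≤ ‖cin i‖)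
    (hout0 : ∀ i, cout i ≠ 0) (houtΛ : ∀ i, cout i ∈ logUnits (k i)) (hdom : ∀ i, ∀ z ∈ logUnits (k i), ‖z‖ ≤ ‖cout i‖)
    {Rin Rout : ℤ} (hRin : ∀ i, ‖cin i‖ = (p : ℝ) ^ (-((Rin : ℝ) / e))) (hRout : ∀ i, ‖cout i‖ = (p : ℝ) ^ (-((Rout : ℝ) / e)))
    (b b' : I) {tΘ : k b} (htΘ : tΘ ≠ 0) {tq : k b'} {M mq : ℤ} (hΘ : ‖tΘ‖ = (p : ℝ) ^ (-((M : ℝ) / e)))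
    (hq : ‖tq‖ = (p : ℝ) ^ (-((mq : ℝ) / e))) :
    iota p k b' tq • (normalizedPacket p k : Set (PacketAlgebra p k)) ⊆
        packetHull p k (⋃ g : indTwo p k, g • (iota p k b tΘ • (normalizedPacket p k : Set (PacketAlgebra p k)))) ↔
      (e : ℤ) * ((M - (Fintype.card I - 1 : ℕ) * (D : ℤ) - Fintype.card I * Rin) / e) + Fintype.card I * Rout ≤ mq := by
  have hcard : 1 ≤ Fintype.card I := Fintype.card_pos
  have he0 : (0 : ℤ) < (e : ℤ) := by exact_mod_cast he
  have he' : (e : ℝ) ≠ 0 := by exact_mod_cast he.ne'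
  rw [iota_smul_subset_packetHull_orbit_iota_smul_iff_inf p k hin0 hin hmax hout0 houtΛ hdom b b' htΘ tq,
    dSum_sub_inf_differentOrd_dFac_eq_of_algEquiv' p k τ]
  simp only [hRin, hRout, Finset.prod_const, Finset.card_univ, hΘ, hq]
  have hL : ∀ m : ℤ, ((p : ℝ) ^ m * (p : ℝ) ^ (-((M : ℝ) / e)) ≤
      (p : ℝ) ^ (-(((Fintype.card I : ℝ) - 1) * differentOrd p K)) * ((p : ℝ) ^ (-((Rin : ℝ) / e))) ^ Fintype.card I) ↔
        m * (e : ℤ) ≤ M - (Fintype.card I - 1 : ℕ) * (D : ℤ) - Fintype.card I * Rin := by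
    intro m
    rw [zpow_mul_rpow_le_rpow_mul_rpow_pow_iff p he m M Rin (((Fintype.card I : ℝ) - 1) * differentOrd p K) (Fintype.card I), hD]
    have h1 : -(((Fintype.card I : ℝ) - 1) * ((D : ℝ) / e)) * e = -(((Fintype.card I : ℝ) - 1) * D) := by field_simp
    rw [h1]
    constructor
    · intro h
      have h' : ((m * (e : ℤ) : ℤ) : ℝ) ≤ ((M - (Fintype.card I - 1 : ℕ) * (D : ℤ) - Fintype.card I * Rin : ℤ) : ℝ) := by
        push_cast; rw [Nat.cast_sub hcard]; push_cast; linarith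
      exact_mod_cast h'
    · intro h
      have h' : ((m * (e : ℤ) : ℤ) : ℝ) ≤ ((M - (Fintype.card I - 1 : ℕ) * (D : ℤ) - Fintype.card I * Rin : ℤ) : ℝ) := by
        exact_mod_cast h
      push_cast at h'; rw [Nat.cast_sub hcard] at h'; push_cast at h'; linarith
  have hR : ∀ m : ℤ, ((p : ℝ) ^ m * (p : ℝ) ^ (-((mq : ℝ) / e)) ≤ ((p : ℝ) ^ (-((Rout : ℝ) / e))) ^ Fintype.card I) ↔
      (e : ℤ) * m + Fintype.card I * Rout ≤ mq := by
    intro m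
    have h := zpow_mul_rpow_le_rpow_mul_rpow_pow_iff p he m mq Rout 0 (Fintype.card I)
    rw [neg_zero, Real.rpow_zero, one_mul] at h
    rw [h]
    constructor
    · intro h'
      have h'' : ((((e : ℤ) * m + Fintype.card I * Rout : ℤ)) : ℝ) ≤ ((mq : ℤ) : ℝ) := by push_cast; linarith
      exact_mod_cast h''
    · intro h'
      have h'' : ((((e : ℤ) * m + Fintype.card I * Rout : ℤ)) : ℝ) ≤ ((mq : ℤ) : ℝ) := by exact_mod_cast h'
      push_cast at h''; linarith
  simp_rw [hL, hR]
  exact forall_int_mul_le_imp_iff_ediv' he0 _ _ _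

/-- **The same for the FACTORWISE (Ind2)** ([IUTchIII] Thm. 3.11 (i)).
[cite: Mochizuki2012, IUTchIII Thm. 3.11 (i) (Ind2) p. 154] [cite: DupuyHilado2025, §4.9] -/
theorem iota_smul_subset_packetHull_factorwiseOrbit_iota_smul_iff_orders_of_algEquiv (τ : ∀ i, K ≃ₐ[ℚ_[p]] k i) {e : ℕ}
    (he : 0 < e) {D : ℕ} (hD : differentOrd p K = (D : ℝ) / e) {cin cout : Π i, k i} (hin0 : ∀ i, cin i ≠ 0)
    (hin : ∀ i (o : k i), ‖o‖ ≤ 1 → cin i * o ∈ logUnits (k i))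
    (hmax : ∀ i, ∃ (ϖ : (k i)ˣ) (w : k i), IsUniformizer ϖ ∧ w ∉ logUnits (k i) ∧ ‖w‖ * ‖(ϖ : k i)‖ ≤ ‖cin i‖)
    (hout0 : ∀ i, cout i ≠ 0) (houtΛ : ∀ i, cout i ∈ logUnits (k i)) (hdom : ∀ i, ∀ z ∈ logUnits (k i), ‖z‖ ≤ ‖cout i‖)
    {Rin Rout : ℤ} (hRin : ∀ i, ‖cin i‖ = (p : ℝ) ^ (-((Rin : ℝ) / e))) (hRout : ∀ i, ‖cout i‖ = (p : ℝ) ^ (-((Rout : ℝ) / e)))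
    (b b' : I) {tΘ : k b} (htΘ : tΘ ≠ 0) {tq : k b'} {M mq : ℤ} (hΘ : ‖tΘ‖ = (p : ℝ) ^ (-((M : ℝ) / e)))
    (hq : ‖tq‖ = (p : ℝ) ^ (-((mq : ℝ) / e))) :
    iota p k b' tq • (normalizedPacket p k : Set (PacketAlgebra p k)) ⊆
        packetHull p k (⋃ g ∈ {g : ∀ i, k i ≃ₗ[ℚ_[p]] k i | ∀ i, g i '' logUnits (k i) = logUnits (k i)},
          (PiTensorProduct.congr g : PacketAlgebra p k ≃ₗ[ℚ_[p]] PacketAlgebra p k) ''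
            (iota p k b tΘ • (normalizedPacket p k : Set (PacketAlgebra p k)))) ↔
      (e : ℤ) * ((M - (Fintype.card I - 1 : ℕ) * (D : ℤ) - Fintype.card I * Rin) / e) + Fintype.card I * Rout ≤ mq := by
  rw [iota_smul_subset_packetHull_factorwiseOrbit_iota_smul_iff_inf p k hin0 hin hmax hout0 houtΛ hdom b b' htΘ tq,
    ← iota_smul_subset_packetHull_orbit_iota_smul_iff_inf p k hin0 hin hmax hout0 houtΛ hdom b b' htΘ tq]
  exact iota_smul_subset_packetHull_orbit_iota_smul_iff_orders_of_algEquiv p k τ he hD hin0 hin hmax hout0 houtΛ hdom hRin hRout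
    b b' htΘ hΘ hq

end Conjugate

end Literature.IUT.LogVolume

end
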